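import Summits.CriticalPhenomena.PercolationContinuityZ3.Theorems.Transplant.KNCellsStepsDefsO
import Summits.CriticalPhenomena.PercolationContinuityZ3.Theorems.Transplant.KNCellsStepsDefs
import Summits.CriticalPhenomena.PercolationContinuityZ3.Theorems.Transplant.KNCellsSchemeO
import Summits.CriticalPhenomena.PercolationContinuityZ3.Theorems.Transplant.KNCellsProcessO
import Summits.CriticalPhenomena.PercolationContinuityZ3.Theorems.Transplant.KNCellsStepsReach
import Literature.Probability.Percolation.OrientedHistorySiteRenormalizationRun
import HarnessLib

/-!
# N2 (frames-only node `SamePDropOfSkeletonFrm₁`, OPEN) — ORIENTED MACRO LAYER (WAVE 0 (c1), (R-18) `q ≡ true`): the oriented twin of N1's `KNCellsStepsReach`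

builds on p205010 (kernel theorem, internal audit signed; external expert review pending) — nothing in this file uses p205010; NOTHING is claimed about the
open node `SamePDropOfSkeletonFrm₁` (`SamePDropOfSkeletonNeg₁` is CLOSED in the tree and untouched by this file).
Status sentence (coordinator 2026-08-20T04:30Z): "θ(p_c) = 0 on ℤ^d, all d ≥ 2 — kernel-verified (Lean 4/Mathlib, standard axioms); internal adversarial
audit SIGNED 2026-08-20 04:29Z; external expert review pending."
Lane `prim-bschramm-*`, seat `prim-bschramm-stmt` (gen 19); helper file (`--supports stmt-CriticalPhenomena-4575 --as helper`); N2-SCOPE §20, (R-18)/(R-19).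
PORT RULES (HOME/prim-bschramm-stmt-g19/lean/port_orient.py): the history-site API is replaced by its ORIENTED twin at the fixed quadrant `qNE := fun _ => true`
(`HState.choice ↦ HState.ochoice qNE`, `mstOf ↦ omstOf qNE`, `mst/stN ↦ omst/ostN qNE`, `occFinal ↦ ooccFinal qNE`, `Lawful ↦ OLawful qNE`, onward directions
`onward ↦ onwardO` = the POSITIVE ones, (N2-e)); every declaration whose text changes thereby — directly or through a changed declaration — is re-declared with the
suffix `O` (same namespace); unchanged declarations of the N1 file are NOT repeated (the N1 module is imported). Docstrings/citations are N1's.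
N1 HEADER (kept for the reader):
* `patAnchor`, `GoodPat` (the pattern's anchor; the root reaches `M_v` inside `E_i ∪ E_{w,v}` in the configuration `ξ ∪ P`);
* `real_localCylinder_eq` — the cylinders of `B` have the same mass under every `μ_{a'}` and under `P_p` (fresh edges);
* `real_good_ge` — `Σ_{good P} P_p([P]_B) ≥ P_{W₀}(root ↔ M_v)` (on `[ξ]_F ∩ [P]_B ∩ lattice-only`, the event is decided by `ξ ∪ P`);
* **`sum_real_Reach_compl_inter_Dev_le`** — if `1 - δ < P_{W₀}(root ↔ M_v)` ((32)) and, for every good `P ⊆ B`,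
  `1 - ε'' < P_{pinW μ_{a'(P)} B P}(Reach_{a'(P)})` (Lemma 12 over cells, pattern-pinned — hypothesis `hcorr`), then
  `Σ_{a' ∈ anchSet} μ_{a'}(Reach_{a'}ᶜ ∩ Dev a') ≤ ε'' + δ` — the hypothesis `hreach` of `fail_bound` (part 4c).
[cite: KozmaNitzan2024, §4 p. 30 (Step IV, first claim), p. 31 ((37)) — the ℤ^d model] [cite: GrimmettPercolation1999, §7.2]
-/
noncomputable section

open MeasureTheory ProbabilityTheory
open scoped ENNReal Classical

namespace Summit.CriticalPhenomena.PercolationContinuityZ3.Theorems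

namespace Transplant

namespace KNCells

open Literature.Probability.Percolation Literature.Probability.LatticeModels SimpleGraph GadgetSystem ProbeHistory HSiteScheme Contour

variable {V : Type*} [DecidableEq V] [Countable V]

namespace KSchA

variable {A : Type*} {G : SimpleGraph V} [G.LocallyFinite] (S : KSchA V A)

variable {S}
variable {h : ProbeHistory V} {e : Site 2 × MDir} (hV : S.ValidO G h e) {a : A} {du : MDir} {FD : FaceData V A} (hSt : StepsGeom S.Γ FD)

omit [Countable V] in
/-- On a pattern `P` of the fresh edges, the observation of the envelope restricted to them is `P`, so the chosen anchor is `patAnchor P`. [folklore] -/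
theorem depA_obs_eq_patAnchorO {P : Finset (Sym2 V)} (hP : P ⊆ S.Bfr G h e a) {ω : BondConfig V}
    (hω : ω ∈ localCylinder (↑(S.Bfr G h e a) : Set (Sym2 V)) ↑P) :
    S.depA G h e a (obs ω (S.envO G h e a)) = S.patAnchor G h e a P := by
  unfold depA patAnchor seen
  congr 1
  ext x
  simp only [Finset.mem_union, Finset.mem_inter, mem_obs_iff, Finset.mem_sdiff]
  constructor
  · rintro (hx | ⟨⟨hxe, hxω⟩, hxB, hxF⟩)
    · exact Or.inl hx
    · right
      have := hω x (Finset.mem_coe.2 (Finset.mem_sdiff.2 ⟨hxB, hxF⟩))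
      exact Finset.mem_coe.1 (this.1 hxω)
  · rintro (hx | hx)
    · exact Or.inl hx
    · right
      have hxB := hP hx
      obtain ⟨hxB', hxF⟩ := Finset.mem_sdiff.1 hxB
      have hxe : x ∈ S.envO G h e a := S.revealOf_subset_envO h e a (obs ω (S.envO G h e a)) (S.baseF_sdiff_subset_revealOfO h e a _ hxB)
      have := hω x (Finset.mem_coe.2 hxB)
      exact ⟨⟨hxe, this.2 (Finset.mem_coe.2 hx)⟩, hxB', hxF⟩

omit [Countable V] in
/-- `[P]_B ⊆ DevO (patAnchor P)`. [folklore] -/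
theorem localCylinder_subset_DevO {P : Finset (Sym2 V)} (hP : P ⊆ S.Bfr G h e a) :
    localCylinder (↑(S.Bfr G h e a) : Set (Sym2 V)) ↑P ⊆ S.DevO G h e a (S.patAnchor G h e a P) :=
  fun _ hω => depA_obs_eq_patAnchorO hP hω

omit [Countable V] in
include hSt in
/-- **The cylinders of the fresh edges have the same mass under `μ_{a'}` as under `P_p`** (`a'` admissible). [folklore] -/
theorem real_localCylinder_eqO {a' : A} (ha' : a' ∈ S.Γ.anchSet a (tgt e)) (P : Finset (Sym2 V)) : (((prodBernoulli (S.Wfull G h e a a' du)).real (localCylinder (↑(S.Bfr G h e a) : Set (Sym2 V)) ↑P) =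
      (bondPercolation G S.p).real (localCylinder (↑(S.Bfr G h e a) : Set (Sym2 V)) ↑P)) : Prop) := by
  rw [← KNLevels.prodBernoulli_lattW]
  refine prodBernoulli_real_eq_of_determinedBy _ _ (fun x hx => ?_) (determinedBy_localCylinder _ _)
    (measurableSet_localCylinder (S.Bfr G h e a).finite_toSet.countable _)
  obtain ⟨hx1, hx2⟩ := Finset.mem_sdiff.1 (Finset.mem_coe.1 hx)
  have hxS : x ∈ wireSet (↑(S.Sx G h e a a' du) : Set V) :=
    coe_Fp_subset_wireSet hSt h e ha' du (Nat.zero_le _) (Finset.mem_coe.2 (baseF_subset_Fp h e a a' du 0 hx1))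
  unfold Wfull
  rw [restrW_apply_of_mem _ hxS, pinW_apply_of_not_mem _ _ (fun h' => hx2 (Finset.mem_coe.1 h'))]

include hV in
/-- **The good patterns carry at least the mass of (32)**: `P_{W₀}(root ↔ M_v) ≤ Σ_{good P ⊆ B} P_p([P]_B)` — under the pinned weighting the
recorded pattern holds a.s. and no non-edge is open, so on `[P]_B` the event is decided by `ξ ∪ P`. [cite: KozmaNitzan2024, §4 p. 28 ((32))] -/
theorem real_W₀_le_sum_goodO : (((prodBernoulli (S.W₀ G h e a)).real (⋃ t ∈ S.Γ.M a (tgt e), openConn S.Γ.root t) ≤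
      ∑ P ∈ (S.Bfr G h e a).powerset.filter (fun P => S.GoodPat G h e a P),
        (bondPercolation G S.p).real (localCylinder (↑(S.Bfr G h e a) : Set (Sym2 V)) ↑P)) : Prop) := by
  set B := S.Bfr G h e a with hB
  set μ₀ := prodBernoulli (pinW (KNLevels.lattW G S.p) ↑(S.F G h) ↑(S.ξ G h)) with hμ₀
  set D := S.Vx G h ∪ S.Γ.Ewv a e.1 e.2 with hD
  have h0 : S.Γ.root ∈ (↑D : Set V) := Finset.mem_coe.2 (Finset.mem_union_left _ hV.root_mem)
  -- `P_{W₀}(root ↔ M_v) = μ₀(ReachM)`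
  have e1 : (prodBernoulli (S.W₀ G h e a)).real (⋃ t ∈ S.Γ.M a (tgt e), openConn S.Γ.root t) = μ₀.real (S.ReachM G h e a) := by
    rw [W₀, ← Finset.set_biUnion_coe, prodBernoulli_restrW_real_biUnion_openConn _ _ h0]; rfl
  rw [e1]
  -- a.s. under `μ₀`: the recorded pattern on `F`, no non-edge open
  have hae1 : ∀ᵐ ω ∂μ₀, ω ∈ localCylinder (↑(S.F G h) : Set (Sym2 V)) ↑(S.ξ G h) :=
    prodBernoulli_pinW_ae_localCylinder _ (S.F G h).finite_toSet.countable _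
  have hae2 : ∀ᵐ ω ∂μ₀, ∀ x ∈ {x : Sym2 V | x ∉ G.edgeSet}, x ∉ ω := by
    refine prodBernoulli_ae_forall_notMem _ (Set.to_countable _) fun x hx => ?_
    have hxF : x ∉ (↑(S.F G h) : Set (Sym2 V)) := fun h' => hx (by
      have := Finset.mem_coe.1 h'; rw [hV.F_eq, mem_edgesIn_iff] at this; exact this.1)
    rw [pinW_apply_of_not_mem _ _ hxF, KNLevels.lattW_apply, if_neg hx]
  -- on these, `ReachM` holds iff the pattern of `B` is good
  have hkey : ∀ ω, ω ∈ localCylinder (↑(S.F G h) : Set (Sym2 V)) ↑(S.ξ G h) → (∀ x ∈ {x : Sym2 V | x ∉ G.edgeSet}, x ∉ ω) →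
      ω ∈ S.ReachM G h e a → ∃ P ∈ B.powerset.filter (fun P => S.GoodPat G h e a P), ω ∈ localCylinder (↑B : Set (Sym2 V)) ↑P := by
    intro ω hω1 hω2 hωR
    refine ⟨B.filter (· ∈ ω), Finset.mem_filter.2 ⟨Finset.mem_powerset.2 (Finset.filter_subset _ _), ?_⟩, ?_⟩
    · -- `ξ ∪ (ω ∩ B)` agrees with `ω` on every pair inside `D`
      have hag : ∀ x ∈ wireSet (↑D : Set V), x ∈ ω ↔ x ∈ ((↑(S.ξ G h) : Set (Sym2 V)) ∪ ↑(B.filter (· ∈ ω))) := by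
        intro x hxD
        by_cases hxE : x ∈ G.edgeSet
        · have hxbase : x ∈ S.baseF G h e a := by
            rw [baseF, mem_edgesIn_iff]
            exact ⟨hxE, fun y hy => Finset.mem_coe.1 (hxD.1 y hy)⟩
          by_cases hxF : x ∈ S.F G h
          · have h1 := hω1 x (Finset.mem_coe.2 hxF)
            rw [Finset.mem_coe] at h1
            constructor
            · intro hxω; exact Or.inl (Finset.mem_coe.2 (h1.1 hxω))
            · rintro (h2 | h2)
              · exact h1.2 (Finset.mem_coe.1 h2)
              · exact (Finset.mem_filter.1 (Finset.mem_coe.1 h2)).2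
          · constructor
            · intro hxω
              exact Or.inr (Finset.mem_coe.2 (Finset.mem_filter.2 ⟨Finset.mem_sdiff.2 ⟨hxbase, hxF⟩, hxω⟩))
            · rintro (h2 | h2)
              · exact absurd (hV.ξ_sub (Finset.mem_coe.1 h2)) hxF
              · exact (Finset.mem_filter.1 (Finset.mem_coe.1 h2)).2
        · constructor
          · intro hxω; exact absurd hxω (hω2 x hxE)
          · rintro (h2 | h2)
            · exact absurd (hV.mem_edgeSet_of_mem_F (hV.ξ_sub (Finset.mem_coe.1 h2))) hxE
            · have := (Finset.mem_sdiff.1 (Finset.mem_filter.1 (Finset.mem_coe.1 h2)).1).1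
              rw [baseF, mem_edgesIn_iff] at this
              exact absurd this.1 hxE
      have hdet := determinedBy_biUnion_openConnIn (↑D : Set V) S.Γ.root (↑(S.Γ.M a (tgt e)) : Set V) subset_rfl
      rw [determinedBy_iff] at hdet
      unfold GoodPat ReachM
      refine (hdet ω _ ?_).1 hωR
      ext x
      simp only [Set.mem_inter_iff]
      constructor
      · rintro ⟨hxω, hxD⟩; exact ⟨(hag x hxD).1 hxω, hxD⟩
      · rintro ⟨hx, hxD⟩; exact ⟨(hag x hxD).2 hx, hxD⟩
    · intro x hx
      simp only [Finset.coe_filter, Set.mem_setOf_eq]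
      exact ⟨fun h' => ⟨Finset.mem_coe.1 hx, h'⟩, fun h' => h'.2⟩
  have hcov : μ₀.real (S.ReachM G h e a) ≤ μ₀.real (⋃ P ∈ B.powerset.filter (fun P => S.GoodPat G h e a P),
      localCylinder (↑B : Set (Sym2 V)) ↑P) := by
    set N : Set (BondConfig V) := {ω | ¬(ω ∈ localCylinder (↑(S.F G h) : Set (Sym2 V)) ↑(S.ξ G h) ∧
      ∀ x ∈ {x : Sym2 V | x ∉ G.edgeSet}, x ∉ ω)} with hN
    have hN0 : μ₀.real N = 0 := by
      rw [measureReal_eq_zero_iff]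
      exact ae_iff.1 (by filter_upwards [hae1, hae2] with ω h1 h2; exact ⟨h1, h2⟩)
    have hsub : S.ReachM G h e a ⊆ (⋃ P ∈ B.powerset.filter (fun P => S.GoodPat G h e a P),
        localCylinder (↑B : Set (Sym2 V)) ↑P) ∪ N := by
      intro ω hωR
      by_cases hω : ω ∈ N
      · exact Or.inr hω
      · simp only [hN, Set.mem_setOf_eq, not_not] at hω
        obtain ⟨P, hP, hωP⟩ := hkey ω hω.1 hω.2 hωR
        exact Or.inl (Set.mem_biUnion hP hωP)
    calc μ₀.real (S.ReachM G h e a) ≤ μ₀.real (⋃ P ∈ B.powerset.filter (fun P => S.GoodPat G h e a P),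
          localCylinder (↑B : Set (Sym2 V)) ↑P) + μ₀.real N :=
          (measureReal_mono hsub (measure_ne_top _ _)).trans (measureReal_union_le _ _)
      _ = _ := by rw [hN0, add_zero]
  refine hcov.trans ((measureReal_biUnion_finset_le _ _).trans (le_of_eq (Finset.sum_congr rfl fun P _ => ?_)))
  -- cylinders of fresh edges: `μ₀ = P_p` on `B`
  rw [← KNLevels.prodBernoulli_lattW]
  refine prodBernoulli_real_eq_of_determinedBy _ _ (fun x hx => ?_) (determinedBy_localCylinder _ _)
    (measurableSet_localCylinder B.finite_toSet.countable _)
  exact pinW_apply_of_not_mem _ _ (fun h' => (Finset.mem_sdiff.1 (Finset.mem_coe.1 hx)).2 (Finset.mem_coe.1 h'))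

include hV hSt in
/-- **The summed corridor bound (I1) of `fail_bound`**: if `1 - δ < P_{W₀}(root ↔ M_v)` ((32)) and for every good pattern `P` of the fresh edges
of `E_i ∪ E_{w,v}` Lemma 12 holds under `μ_{a'(P)}` pinned along `P` with loss `ε''` (`hcorr`), then `Σ_{a'} μ_{a'}(Reach_{a'}ᶜ ∩ DevO a') ≤ ε'' + δ`.
[cite: KozmaNitzan2024, §4 p. 30 (Step IV, first claim), p. 31 ((37))] -/
theorem sum_real_Reach_compl_inter_Dev_leO {ε'' δ : ℝ} (hε'' : 0 ≤ ε'')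
    (h32 : 1 - δ < (prodBernoulli (S.W₀ G h e a)).real (⋃ t ∈ S.Γ.M a (tgt e), openConn S.Γ.root t))
    (hcorr : ∀ P ⊆ S.Bfr G h e a, S.GoodPat G h e a P →
      1 - ε'' < (prodBernoulli (pinW (S.Wfull G h e a (S.patAnchor G h e a P) du) ↑(S.Bfr G h e a) ↑P)).real
        (S.Reach G FD h e a (S.patAnchor G h e a P) du)) :
    ∑ a' ∈ S.Γ.anchSet a (tgt e), (prodBernoulli (S.Wfull G h e a a' du)).real ((S.Reach G FD h e a a' du)ᶜ ∩ S.DevO G h e a a') ≤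
      ε'' + δ := by
  set B := S.Bfr G h e a with hB
  set T := S.Γ.anchSet a (tgt e) with hT
  set π : Finset (Sym2 V) → ℝ := fun P => (bondPercolation G S.p).real (localCylinder (↑B : Set (Sym2 V)) ↑P) with hπ
  set gP : Finset (Sym2 V) → ℝ := fun P => if S.GoodPat G h e a P then ε'' else 1 with hgP
  have hRm : ∀ a', MeasurableSet (S.Reach G FD h e a a' du) := fun a' => measurableSet_biUnion_openConnIn _ _ _
  have hmem : ∀ P ∈ B.powerset, (↑P : Set (Sym2 V)) ∈ S.DevO G h e a (S.patAnchor G h e a P) := fun P hP =>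
    localCylinder_subset_DevO (Finset.mem_powerset.1 hP) (fun x _ => Iff.rfl)
  -- per anchor: decompose over the patterns choosing it
  have hper : ∀ a' ∈ T, (prodBernoulli (S.Wfull G h e a a' du)).real ((S.Reach G FD h e a a' du)ᶜ ∩ S.DevO G h e a a') ≤
      ∑ P ∈ B.powerset.filter (fun P => S.patAnchor G h e a P = a'), π P * gP P := by
    intro a' ha'
    rw [prodBernoulli_real_inter_eq_sum_pinW _ B (hRm a').compl (determinedBy_DevO h e a a')]
    have hfilt : B.powerset.filter (fun P : Finset (Sym2 V) => (↑P : Set (Sym2 V)) ∈ S.DevO G h e a a') =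
        B.powerset.filter (fun P => S.patAnchor G h e a P = a') := by
      refine Finset.filter_congr fun P hP => ?_
      have h1 : S.depA G h e a (obs ↑P (S.envO G h e a)) = S.patAnchor G h e a P :=
        depA_obs_eq_patAnchorO (Finset.mem_powerset.1 hP) (fun x _ => Iff.rfl)
      simp only [DevO, Set.mem_setOf_eq, h1]
    rw [hfilt]
    refine Finset.sum_le_sum fun P hP => ?_
    obtain ⟨hPB, hPa⟩ := Finset.mem_filter.1 hP
    rw [real_localCylinder_eqO hSt ha' P]
    refine mul_le_mul_of_nonneg_left ?_ measureReal_nonneg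
    by_cases hg : S.GoodPat G h e a P
    · rw [hgP]; simp only [hg, if_true]
      have h1 := hcorr P (Finset.mem_powerset.1 hPB) hg
      rw [hPa] at h1
      rw [measureReal_compl (hRm a'), probReal_univ]
      linarith
    · rw [hgP]; simp only [hg, if_false]; exact measureReal_le_one
  -- collect the patterns
  have hcollect : ∑ a' ∈ T, ∑ P ∈ B.powerset.filter (fun P => S.patAnchor G h e a P = a'), π P * gP P =
      ∑ P ∈ B.powerset, π P * gP P :=
    Finset.sum_fiberwise_of_maps_to (fun P _ => S.Γ.anchor_mem _ _ _) _
  -- the bad patterns have mass `< δ`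
  have hπsum : ∑ P ∈ B.powerset, π P = 1 := by
    have := prodBernoulli_real_eq_sum_localCylinder (KNLevels.lattW G S.p) B (determinedBy_univ (↑B : Set (Sym2 V)))
    rw [probReal_univ] at this
    rw [hπ, ← KNLevels.prodBernoulli_lattW, this]
    exact (Finset.sum_congr (by ext P; simp) fun P _ => rfl).symm
  have hgood : 1 - δ < ∑ P ∈ B.powerset.filter (fun P => S.GoodPat G h e a P), π P :=
    h32.trans_le (real_W₀_le_sum_goodO hV)
  have hsplit : ∑ P ∈ B.powerset, π P * gP P =
      ε'' * ∑ P ∈ B.powerset.filter (fun P => S.GoodPat G h e a P), π P +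
        ∑ P ∈ B.powerset.filter (fun P => ¬S.GoodPat G h e a P), π P := by
    rw [← Finset.sum_filter_add_sum_filter_not B.powerset (fun P => S.GoodPat G h e a P), Finset.mul_sum]
    congr 1
    · refine Finset.sum_congr rfl fun P hP => ?_
      rw [hgP]; simp only [(Finset.mem_filter.1 hP).2, if_true]; ring
    · refine Finset.sum_congr rfl fun P hP => ?_
      rw [hgP]; simp only [(Finset.mem_filter.1 hP).2, if_false, mul_one]
  have hbad : ∑ P ∈ B.powerset.filter (fun P => ¬S.GoodPat G h e a P), π P =
      1 - ∑ P ∈ B.powerset.filter (fun P => S.GoodPat G h e a P), π P := by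
    rw [← hπsum, ← Finset.sum_filter_add_sum_filter_not B.powerset (fun P => S.GoodPat G h e a P)]; ring
  have hgle : ∑ P ∈ B.powerset.filter (fun P => S.GoodPat G h e a P), π P ≤ 1 := by
    rw [← hπsum]
    exact Finset.sum_le_sum_of_subset_of_nonneg (Finset.filter_subset _ _) fun P _ _ => measureReal_nonneg
  calc ∑ a' ∈ T, (prodBernoulli (S.Wfull G h e a a' du)).real ((S.Reach G FD h e a a' du)ᶜ ∩ S.DevO G h e a a')
      ≤ ∑ a' ∈ T, ∑ P ∈ B.powerset.filter (fun P => S.patAnchor G h e a P = a'), π P * gP P := Finset.sum_le_sum hper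
    _ = ∑ P ∈ B.powerset, π P * gP P := hcollect
    _ ≤ ε'' + δ := by rw [hsplit, hbad]; nlinarith

end KSchA

end KNCells

end Transplant

end Summit.CriticalPhenomena.PercolationContinuityZ3.Theorems

end
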